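import Summits.BirchSwinnertonDyer.BirchSwinnertonDyer.Theorems.RamifiedHeegnerPairLeafPartnerGenusLevel
import Summits.BirchSwinnertonDyer.Rank1Residual.X11b.KolyvaginTowerLiftConcrete
import HarnessLib

/-!
# Crux U₁ `LeafRankOneUpperAtThree` (stmt-BirchSwinnertonDyer-26022) ∕ U₀ (26024), line `partnerdescent` — partner kernel part 16:
# `θ`-FIXING LIFTS `Gal(K[m]/K) → Gal(K[3m]/K)` and the EQUIVARIANCE of the level-`m` descent `D_m ↦ ψ_θ(z_m)`

HONEST FRAMING (lead prover `bsd-line-rhp-p2` g58, explicit-unit seat, cell `bsd-wall`): a SUPPORT file (`--supports 26022 --as helper`)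
for the registered stub (DISPLAY-L) `stub_partnerGenusDisplayLabelledAtThree`. It proves NO stub and closes NO item; BSD is proved for no
curve. Theorems only; no definition, no named fact, no `sorry`.

WHAT. Every label of `ShimuraWalk.LabelsAt` for the descended family `ys(m) = c·χ₋₃(m)·D_m` ((B2) bottom trace, (B3) reflection, (B4) norm)
is an identity between Galois conjugates of `D_m ∈ W(K[m])`; read in `W(K[3m])` through the injective inclusion it becomes an identity between
conjugates of `ψ_θ(z_m)`, `z_m = (1 − σ_m)·y(3m)`, by elements of `Gal(K[3m]/K)` that FIX `θ = √−3` — on which `ψ_θ` is equivariant (part 10).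
This file supplies exactly that dictionary, over the tree's restriction homomorphism `res : Gal(K[3m]/K) → Aut(K[m])`
(`X11b.RingClassTower.exists_restrictHom`, value formula `res(g)(x) = g(x)`):
* §1 `exists_lift_apply_theta_eq` — every `g ∈ Gal(K[m]/K)` has a lift `g̃ ∈ Gal(K[3m]/K)` with `res g̃ = g` AND `g̃ θ = θ` (lift by
  `exists_restrictHom_eq`; if the lift negates `θ`, multiply by the genus involution `σ_m ∈ ker res`).
* §2 `map_inclusion_pointGalHom_res_eq` — for `D ∈ W(K[m])` with `D↑ = ψ_θ(z)` and `g̃` fixing `θ`: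
  `(res g̃ · D)↑ = ψ_θ(g̃ · z)` (`pointGalHom_restrictHom_map_inclusion` + part 10 `genusTransport_map_of_eq`).
* §3 `map_inclusion_injective'` — the inclusion on points is injective (identities may be checked upstairs).
[cite: GrossLMS1991, §3 (p. 216: the tower; res), §4 (4.1)] [cite: SilvermanAEC2009, X.5 Cor. 5.4 (iii), VIII.§1]
presearch: as parts 14–15 (the genus descent is not printed; tree: X11b.RingClassTower restriction API, part 10); nothing restated.
-/

set_option linter.dupNamespace false
set_option autoImplicit false

noncomputable section

open scoped Classical

namespace Summit.BirchSwinnertonDyer.BirchSwinnertonDyer.Theorems.LeafPartnerGenusLift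

open WeierstrassCurve NumberField Literature.NumberTheory.EllipticCurves
  Literature.NumberTheory.EllipticCurves.RingClassField
  Summit.BirchSwinnertonDyer.Rank1Residual.X11b.RingClassTower
  Summit.BirchSwinnertonDyer.BirchSwinnertonDyer.Theorems.LeafPartnerGenusTransport
  Summit.BirchSwinnertonDyer.BirchSwinnertonDyer.Theorems.LeafPartnerGenusBottom

variable {K : Type} [Field K] [NumberField K]

/-! ## §1 `θ`-fixing lifts -/

/-- **Every `g ∈ Gal(K[m]/K)` lifts to `Gal(K[3m]/K)` FIXING `θ`.** With `res : Gal(K[3m]/K) → Aut(K[m])` the restriction (value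
formula `hres`), `σ ∈ Gal(K[3m]/K[m])` with `σ θ = −θ` (the genus involution of part 15): for `g ∈ Gal(K[m]/K)` there is
`g̃ ∈ Gal(K[3m]/K)` with `res g̃ = g` and `g̃ θ = θ` (`res` is onto; `σ ∈ ker res` flips the sign). [cite: GrossLMS1991, §3 (p. 216)] -/
theorem exists_lift_apply_theta_eq (hK : IsImaginaryQuadratic K) (ι : K →+* ℂ) {m : ℕ} (hm : m ≠ 0)
    {res : ringClassGal ι (3 * m) →* (ringClassField K ι m ≃ₐ[ℚ] ringClassField K ι m)}
    (hres : ∀ (g : ringClassGal ι (3 * m)) (x : ringClassField K ι m) (y : ringClassField K ι (3 * m)),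
      (x : ℂ) = (y : ℂ) → ((res g x : ringClassField K ι m) : ℂ) =
        (((g : ringClassField K ι (3 * m) ≃ₐ[ℚ] ringClassField K ι (3 * m)) y : ringClassField K ι (3 * m)) : ℂ))
    {σ : ringClassField K ι (3 * m) ≃ₐ[ℚ] ringClassField K ι (3 * m)} (hσ : σ ∈ ringClassGalOver ι (3 * m) m)
    {θ : ringClassField K ι (3 * m)} (hθ2 : θ ^ 2 = algebraMap ℚ (ringClassField K ι (3 * m)) (-3)) (hσθ : σ θ = -θ)
    {g : ringClassField K ι m ≃ₐ[ℚ] ringClassField K ι m} (hg : g ∈ ringClassGal ι m) :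
    ∃ gt : ringClassGal ι (3 * m), res gt = g ∧ (gt : ringClassField K ι (3 * m) ≃ₐ[ℚ] ringClassField K ι (3 * m)) θ = θ := by
  have hn : 3 * m ≠ 0 := mul_ne_zero three_ne_zero hm
  have hmn : m ∣ 3 * m := dvd_mul_left m 3
  obtain ⟨g₀, hg₀⟩ := exists_restrictHom_eq hK ι hmn hn hres hg
  rcases algEquiv_apply_eq_or_eq_neg_of_sq_eq hθ2 (g₀ : ringClassField K ι (3 * m) ≃ₐ[ℚ] ringClassField K ι (3 * m)) with h | h
  · exact ⟨g₀, hg₀, h⟩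
  · have hσG : σ ∈ ringClassGal ι (3 * m) := ringClassGalOver_le_ringClassGal ι (3 * m) m hσ
    refine ⟨g₀ * ⟨σ, hσG⟩, ?_, ?_⟩
    · rw [map_mul, hg₀, restrictHom_eq_one_of_mem hK ι hmn hn hres ⟨σ, hσG⟩ hσ, mul_one]
    · change (g₀ : ringClassField K ι (3 * m) ≃ₐ[ℚ] ringClassField K ι (3 * m)) (σ θ) = θ
      rw [hσθ, map_neg, h, neg_neg]

/-! ## §2 Equivariance of the descent read upstairs -/

section Equivariance

variable (W : WeierstrassCurve ℚ) {W₁ : WeierstrassCurve ℚ} [W₁.IsCharNeTwoNF] (C₁ : VariableChange ℚ) (hC₁ : C₁ • W = W₁)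
  {V : WeierstrassCurve ℚ} (CV : VariableChange ℚ) (hV : CV • W₁.quadraticTwist (-3) = V)

/-- **`(res g̃ · D)↑ = ψ_θ(g̃ · z)`** for `D ∈ W(K[m])` with `D↑K[3m] = ψ_θ(z)` (`z ∈ V(K[3m])`) and `g̃ ∈ Gal(K[3m]/K)` fixing `θ`:
the inclusion is `Gal`-equivariant for the two actions through `res` (`pointGalHom_restrictHom_map_inclusion`, with the identity
restriction at the top level), and `ψ_θ` commutes with `θ`-fixing field maps (part 10 `genusTransport_map_of_eq`).
[cite: GrossLMS1991, §3 (p. 216), §4 (4.1)] [cite: SilvermanAEC2009, X.5 Cor. 5.4 (iii)] -/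
theorem map_inclusion_pointGalHom_res_eq (hK : IsImaginaryQuadratic K) (ι : K →+* ℂ) {m : ℕ} (hm : m ≠ 0)
    (hle : ringClassField K ι m ≤ ringClassField K ι (3 * m))
    {res : ringClassGal ι (3 * m) →* (ringClassField K ι m ≃ₐ[ℚ] ringClassField K ι m)}
    (hres : ∀ (g : ringClassGal ι (3 * m)) (x : ringClassField K ι m) (y : ringClassField K ι (3 * m)),
      (x : ℂ) = (y : ℂ) → ((res g x : ringClassField K ι m) : ℂ) =
        (((g : ringClassField K ι (3 * m) ≃ₐ[ℚ] ringClassField K ι (3 * m)) y : ringClassField K ι (3 * m)) : ℂ))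
    {θ : ringClassField K ι (3 * m)} (hθ2 : θ ^ 2 = algebraMap ℚ (ringClassField K ι (3 * m)) (-3))
    (gt : ringClassGal ι (3 * m)) (hgt : (gt : ringClassField K ι (3 * m) ≃ₐ[ℚ] ringClassField K ι (3 * m)) θ = θ)
    (z : (V.baseChange (ringClassField K ι (3 * m))).toAffine.Point) (D : (W.baseChange (ringClassField K ι m)).toAffine.Point)
    (hD : Affine.Point.map ((RingClassField.inclusion ι hle).restrictScalars ℚ) D = genusTransport W C₁ hC₁ CV hV hθ2 z) :
    Affine.Point.map ((RingClassField.inclusion ι hle).restrictScalars ℚ) (pointGalHom W (ringClassField K ι m) (res gt) D) =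
      genusTransport W C₁ hC₁ CV hV hθ2 (pointGalHom V (ringClassField K ι (3 * m)) gt z) := by
  have hn : 3 * m ≠ 0 := mul_ne_zero three_ne_zero hm
  have hmn : m ∣ 3 * m := dvd_mul_left m 3
  letI : Algebra K ℂ := ι.toAlgebra
  -- the identity restriction at the top level has the value formula
  have hid : ∀ (g : ringClassGal ι (3 * m)) (x : ringClassField K ι (3 * m)) (y : ringClassField K ι (3 * m)),
      (x : ℂ) = (y : ℂ) → (((ringClassGal ι (3 * m)).subtype g x : ringClassField K ι (3 * m)) : ℂ) =
        (((g : ringClassField K ι (3 * m) ≃ₐ[ℚ] ringClassField K ι (3 * m)) y : ringClassField K ι (3 * m)) : ℂ) := by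
    intro g x y hxy
    have : x = y := Subtype.ext hxy
    rw [this]; rfl
  have h1 := pointGalHom_restrictHom_map_inclusion (W := W) hK ι hmn (dvd_refl (3 * m)) hn hle hid hres gt D
  change pointGalHom W (ringClassField K ι (3 * m)) gt _ = _ at h1
  rw [← h1, hD, pointGalHom_apply, pointGalHom_apply]
  exact genusTransport_map_of_eq W C₁ hC₁ CV hV hθ2 hθ2 _ hgt z

end Equivariance

/-! ## §3 Injectivity of the inclusion on points -/

/-- The inclusion `K[m] → K[n]` is injective on points (so identities between level-`m` points may be checked in `W(K[n])`).
[cite: GrossLMS1991, §1 (all fields inside ℂ)] -/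
theorem map_inclusion_injective' (W : WeierstrassCurve ℚ) (ι : K →+* ℂ) {m n : ℕ}
    (hle : ringClassField K ι m ≤ ringClassField K ι n) :
    Function.Injective (Affine.Point.map (W' := W) ((RingClassField.inclusion ι hle).restrictScalars ℚ)) :=
  Affine.Point.map_injective (W' := W) ((RingClassField.inclusion ι hle).restrictScalars ℚ)

end Summit.BirchSwinnertonDyer.BirchSwinnertonDyer.Theorems.LeafPartnerGenusLift

end
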